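import Literature.NumberTheory.EllipticCurves.PrimaryGroupStableImage
import Mathlib.NumberTheory.Padics.PadicVal.Basic
import HarnessLib

/-!
# Class X11b, route p2: the ALGEBRA of Greenberg's Lemma 3.3 at a BAD place — the cokernel of
# `γ - 1` on `E(K_{∞,w})[p^∞]` is bounded by the `p`-part of the Tamagawa number
# (cell `b2b-bsdres`, sub-cell `multr1-p2`, gen 13)

HONEST FRAMING (verbatim, cell `b2b-bsdres`): the goal of the cell is to DELETE the
COMBINATION-SHAPED residual classes for ALL analytic-rank `≤ 1` curves over `ℚ` — "full BSD
formula for every rank `≤ 1` curve in class `C`" assembled STRICTLY from published theorems — so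
that the rank-`≤ 1` remainder becomes exactly the CONSTRUCTION-SHAPED classes, which are TYPED
(missing-input Props), NOT attempted; this is not "finishing BSD". Research route `p2` for class
X11b; no claim beyond the stated class; nothing booked; X11b stays CONSTRUCTION-SHAPED. Theorems
only (pure algebra); no definition, no named fact, no `sorry`. Companion of
`BDPRouteControlSnake.lean` (gen 13): there route p2's control input (CTL≤)ᵗ was reduced to the
kernel-proved counting snake lemma plus (c) LOCAL KERNEL BOUNDS `#ker r_v ≤ c_v^{(p)}` at the bad
places `v ∤ p` (Greenberg, LNM 1716, Lemma 3.3 and the remark following it) and (d) one bound on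
`#Sel_𝔭(K, E[p^∞])`. This file proves the ABSTRACT-ALGEBRA core of (c), in the style of the tree's
`Literature.NumberTheory.EllipticCurves.PrimaryGroup.exists_card_quotient_range_le` (the algebra of
Greenberg's Lemma 3.1, `#B/φ(B) ≤ [B : B_div]`).

## The statement (`natCard_quotient_range_le_pow_padicValNat_relIndex`)

Let `M` be an abelian group (intended: `M = E(K_{∞,w})`, the points over the completion of the
`ℤ_p`-extension at a place `w ∣ v`, `v ∤ p`), `φ` an endomorphism of `M` (intended: `γ_v − 1` for a
topological generator `γ_v` of `Gal(K_{∞,w}/K_v)`, so that `ker φ = E(K_v)`), `M₀ ≤ M` a `φ`-stable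
subgroup of finite index (intended: `E₀(K_{∞,w})`, the points of non-singular reduction — finite
index by Kodaira–Néron over `K_v^{nr} ⊇ K_{∞,w}`, so that `[ker φ : ker φ ⊓ M₀] = [E(K_v) : E₀(K_v)]
= c_v`), `B ≤ M` a `φ`-stable `p`-primary subgroup (intended: `B = M[p^∞] = E(K_{∞,w})[p^∞]`,
Greenberg's `B_v`) such that `φ` maps `B ⊓ M₀` ONTO itself (intended: `H¹(Γ_v, E₀(K_{∞,w})[p^∞]) = 0`,
i.e. `(γ_v − 1)E₀(K_{∞,w})[p^∞] = E₀(K_{∞,w})[p^∞]` — `E₀(K_{∞,w})[p^∞] ≅ Ẽ_ns(k_w)[p^∞]` is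
divisible with finite `γ_v`-invariants). THEN `B/φ(B)` — Greenberg's `H¹(Γ_v, B_v) ≅ ker r_v` —
is finite and

  `#(B/φ(B)) ≤ p ^ ord_p [ker φ : ker φ ⊓ M₀]`   (intended: `#ker r_v ≤ c_v^{(p)}`).

Proof: `B₀ = B ⊓ M₀ ⊆ φ(B)`, so `B/φ(B)` is a quotient of `C/φ̄(C)` for the FINITE group `C = B/B₀`
(`↪ M/M₀`) with the induced endomorphism `φ̄`; `#(C/φ̄(C)) = #ker φ̄`; `ker φ̄` is the image of
`ker(φ|_B)` (a lift `b` with `φ b ∈ B₀ = φ(B₀)` is corrected by `b₀ ∈ B₀` into `ker φ`); the image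
of `ker(φ|_B)` in `C` has the same order as its image in `ker φ/(ker φ ⊓ M₀)`, a `p`-group whose
order divides `[ker φ : ker φ ⊓ M₀]`. The geometric inputs (Kodaira–Néron over `K_{∞,w}`, the
identification `ker(γ_v − 1) = E(K_v)`, the divisibility of `E₀(K_{∞,w})[p^∞]`, and
`ker r_v ≅ H¹(Γ_v, B_v)` by inflation–restriction) are NOT in this file.

References: [GreenbergLNM1716] §3, Lemma 3.3 and its proof (p. 87), §4 proof of Thm. 4.1
(`|ker r_v| = c_v^{(p)}` at bad `v ∤ p`); [SilvermanAEC2009] VII.2.1, VII.6.1 (`E₀`, `c_v`).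
-/

namespace Summit.BirchSwinnertonDyer.Rank1Residual.X11b.TamagawaCoinvariants

variable {M : Type*} [AddCommGroup M]

/-- A finite additive group all of whose elements are killed by powers of the prime `p` has order
`≤ p ^ ord_p n` for every `n ≠ 0` that its order divides (its order is a power of `p`, by Cauchy).
[folklore] -/
theorem natCard_le_pow_padicValNat_of_dvd {G : Type*} [AddCommGroup G] [Finite G] (p : ℕ)
    [hp : Fact p.Prime] (hG : ∀ g : G, ∃ k : ℕ, p ^ k • g = 0) {n : ℕ} (hn : n ≠ 0)
    (hdvd : Nat.card G ∣ n) : Nat.card G ≤ p ^ padicValNat p n := by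
  have hcard : Nat.card G ≠ 0 := Nat.card_pos.ne'
  have hprime : ∀ {q : ℕ}, q.Prime → q ∣ Nat.card G → q = p := by
    intro q hq hqd
    haveI : Fact q.Prime := ⟨hq⟩
    obtain ⟨g, hg⟩ := exists_prime_addOrderOf_dvd_card' q hqd
    obtain ⟨k, hk⟩ := hG g
    have h1 : q ∣ p ^ k := by
      rw [← hg]
      exact addOrderOf_dvd_of_nsmul_eq_zero hk
    exact (Nat.prime_dvd_prime_iff_eq hq hp.out).mp (hq.dvd_of_dvd_pow h1)
  have heq : Nat.card G = p ^ (Nat.card G).primeFactorsList.length :=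
    Nat.eq_prime_pow_of_unique_prime_dvd hcard fun hq hqd ↦ hprime hq hqd
  rw [heq] at hdvd ⊢
  exact Nat.pow_le_pow_right hp.out.pos ((padicValNat_dvd_iff_le hn).mp hdvd)

/-- For a finite abelian group `C` and an endomorphism `ψ`: `#(C/ψ(C)) = #ker ψ`. [folklore] -/
theorem natCard_quotient_range_eq_natCard_ker {C : Type*} [AddCommGroup C] [Finite C]
    (ψ : C →+ C) : Nat.card (C ⧸ ψ.range) = Nat.card ψ.ker := by
  have h1 := AddSubgroup.card_eq_card_quotient_mul_card_addSubgroup ψ.range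
  have h2 := AddSubgroup.card_eq_card_quotient_mul_card_addSubgroup ψ.ker
  rw [Nat.card_congr (QuotientAddGroup.quotientKerEquivRange ψ).toEquiv] at h2
  have hpos : 0 < Nat.card ψ.range := Nat.card_pos
  have h3 : Nat.card (C ⧸ ψ.range) * Nat.card ψ.range = Nat.card ψ.ker * Nat.card ψ.range := by
    rw [← h1, h2, mul_comm]
  exact Nat.eq_of_mul_eq_mul_right hpos h3

/-- **The algebra of Greenberg's Lemma 3.3 at a bad place (`#H¹(Γ_v, B_v) ≤ c_v^{(p)}`).** Let `φ`
be an endomorphism of an abelian group `M`, `M₀ ≤ M` a `φ`-stable subgroup of finite index, `B ≤ M`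
a `φ`-stable subgroup all of whose elements are killed by powers of the prime `p`, `fB = φ|_B`,
and suppose `φ` maps `B ⊓ M₀` onto itself. Then `B/φ(B)` is finite and
`#(B/φ(B)) ≤ p ^ ord_p [ker φ : ker φ ⊓ M₀]` (`[ker φ : ker φ ⊓ M₀] = M₀.relIndex φ.ker`).
Intended: `M = E(K_{∞,w})`, `φ = γ_v − 1`, `M₀ = E₀(K_{∞,w})`, `B = M[p^∞]`, so that
`B/φ(B) = H¹(Γ_v, B_v) ≅ ker r_v` and `[ker φ : ker φ ⊓ M₀] = [E(K_v) : E₀(K_v)] = c_v`.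
[cite: GreenbergLNM1716, §3 Lemma 3.3 (p. 87)] -/
theorem natCard_quotient_range_le_pow_padicValNat_relIndex (p : ℕ) [hp : Fact p.Prime]
    (φ : M →+ M) (M₀ : AddSubgroup M) [M₀.FiniteIndex] (hM₀ : ∀ x ∈ M₀, φ x ∈ M₀)
    (B : AddSubgroup M) (hBp : ∀ b ∈ B, ∃ k : ℕ, p ^ k • b = 0)
    (fB : B →+ B) (hfB : ∀ b : B, (fB b : M) = φ b)
    (hsurj : ∀ b ∈ B, b ∈ M₀ → ∃ b' ∈ B, b' ∈ M₀ ∧ φ b' = b) :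
    Finite (B ⧸ fB.range) ∧
      Nat.card (B ⧸ fB.range) ≤ p ^ padicValNat p (M₀.relIndex φ.ker) := by
  classical
  -- `B₀ = B ⊓ M₀` inside `B`; `C = B/B₀` is finite
  set B₀ : AddSubgroup B := M₀.addSubgroupOf B with hB₀def
  have hmemB₀ : ∀ b : B, b ∈ B₀ ↔ (b : M) ∈ M₀ := fun b ↦ AddSubgroup.mem_addSubgroupOf
  haveI : B₀.FiniteIndex := by rw [hB₀def]; infer_instance
  haveI : Finite (B ⧸ B₀) := AddSubgroup.finite_quotient_of_finiteIndex
  -- `B₀ ⊆ φ(B)`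
  have hB₀le : B₀ ≤ fB.range := by
    intro b hb
    obtain ⟨b', hb'B, -, hφ⟩ := hsurj b b.2 ((hmemB₀ b).mp hb)
    exact ⟨⟨b', hb'B⟩, Subtype.ext (by rw [hfB, hφ])⟩
  -- the induced endomorphism `φ̄` of `C = B/B₀`
  have hB₀stab : B₀ ≤ B₀.comap fB := fun b hb ↦ by
    rw [AddSubgroup.mem_comap, hmemB₀, hfB]
    exact hM₀ _ ((hmemB₀ b).mp hb)
  set ψ : B ⧸ B₀ →+ B ⧸ B₀ := QuotientAddGroup.map B₀ B₀ fB hB₀stab with hψ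
  have hψmk : ∀ b : B, ψ (b : B ⧸ B₀) = ((fB b : B) : B ⧸ B₀) :=
    fun b ↦ QuotientAddGroup.map_mk B₀ B₀ fB hB₀stab b
  -- `B/φ(B)` is a quotient of `C/ψ(C)`
  set π : B ⧸ B₀ →+ B ⧸ fB.range :=
    QuotientAddGroup.map B₀ fB.range (AddMonoidHom.id B) (by rwa [AddSubgroup.comap_id]) with hπ
  have hπmk : ∀ b : B, π (b : B ⧸ B₀) = (b : B ⧸ fB.range) :=
    fun b ↦ QuotientAddGroup.map_mk B₀ fB.range _ _ b
  have hπrange : ψ.range ≤ π.ker := by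
    rintro _ ⟨c, rfl⟩
    induction c using QuotientAddGroup.induction_on with
    | H b =>
      rw [AddMonoidHom.mem_ker, hψmk, hπmk, QuotientAddGroup.eq_zero_iff]
      exact ⟨b, rfl⟩
  let π' : (B ⧸ B₀) ⧸ ψ.range →+ B ⧸ fB.range := QuotientAddGroup.lift ψ.range π hπrange
  have hπ'surj : Function.Surjective π' := by
    intro q
    induction q using QuotientAddGroup.induction_on with
    | H b =>
      refine ⟨((b : B ⧸ B₀) : (B ⧸ B₀) ⧸ ψ.range), ?_⟩
      rw [QuotientAddGroup.lift_mk]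
      exact hπmk b
  haveI : Finite ((B ⧸ B₀) ⧸ ψ.range) := inferInstance
  refine ⟨Finite.of_surjective π' hπ'surj, ?_⟩
  -- `#(C/ψ(C)) = #ker ψ` and `ker ψ ⊆` image of `ker fB`
  have hker_le : ψ.ker ≤ fB.ker.map (QuotientAddGroup.mk' B₀) := by
    intro c hc
    induction c using QuotientAddGroup.induction_on with
    | H b =>
      rw [AddMonoidHom.mem_ker, hψmk, QuotientAddGroup.eq_zero_iff, hmemB₀, hfB] at hc
      obtain ⟨b', hb'B, hb'M₀, hφ⟩ := hsurj (φ b) (by rw [← hfB]; exact (fB b).2) hc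
      rw [AddSubgroup.mem_map]
      refine ⟨b - ⟨b', hb'B⟩, ?_, ?_⟩
      · rw [AddMonoidHom.mem_ker, map_sub, sub_eq_zero]
        exact Subtype.ext (by rw [hfB, hfB, hφ])
      · rw [QuotientAddGroup.mk'_apply, QuotientAddGroup.mk_sub, sub_eq_self,
          QuotientAddGroup.eq_zero_iff, hmemB₀]
        exact hb'M₀
  -- the image of `ker fB` in `C` has the order of its image in `ker φ / (ker φ ⊓ M₀)`
  let ρ : fB.ker →+ B ⧸ B₀ := (QuotientAddGroup.mk' B₀).comp fB.ker.subtype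
  have hρrange : fB.ker.map (QuotientAddGroup.mk' B₀) = ρ.range := by
    rw [AddMonoidHom.range_comp, AddSubgroup.range_subtype]
  let ι : fB.ker →+ φ.ker :=
    { toFun := fun x ↦ ⟨((x : B) : M), by
        rw [AddMonoidHom.mem_ker, ← hfB, show fB (x : B) = 0 from x.2, ZeroMemClass.coe_zero]⟩
      map_zero' := rfl
      map_add' := fun _ _ ↦ rfl }
  let σ : fB.ker →+ φ.ker ⧸ M₀.addSubgroupOf φ.ker :=
    (QuotientAddGroup.mk' (M₀.addSubgroupOf φ.ker)).comp ι
  have hkers : ρ.ker = σ.ker := by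
    ext x
    rw [AddMonoidHom.mem_ker, AddMonoidHom.mem_ker, AddMonoidHom.comp_apply,
      AddMonoidHom.comp_apply, QuotientAddGroup.mk'_apply, QuotientAddGroup.mk'_apply,
      QuotientAddGroup.eq_zero_iff, QuotientAddGroup.eq_zero_iff, hmemB₀,
      AddSubgroup.mem_addSubgroupOf]
    rfl
  haveI : Finite (φ.ker ⧸ M₀.addSubgroupOf φ.ker) := AddSubgroup.finite_quotient_of_finiteIndex
  haveI : Finite σ.range := inferInstance
  have hcardρσ : Nat.card ρ.range = Nat.card σ.range := by
    rw [← Nat.card_congr (QuotientAddGroup.quotientKerEquivRange ρ).toEquiv,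
      ← Nat.card_congr (QuotientAddGroup.quotientKerEquivRange σ).toEquiv, hkers]
  -- `σ.range` is a `p`-group whose order divides `[ker φ : ker φ ⊓ M₀]`
  have hσp : ∀ y : σ.range, ∃ k : ℕ, p ^ k • y = 0 := by
    rintro ⟨_, x, rfl⟩
    obtain ⟨k, hk⟩ := hBp ((x : B) : M) (x : B).2
    refine ⟨k, Subtype.ext ?_⟩
    rw [AddSubgroupClass.coe_nsmul, ZeroMemClass.coe_zero, ← map_nsmul]
    have hx0 : p ^ k • x = 0 := Subtype.ext (Subtype.ext (by
      rw [AddSubgroupClass.coe_nsmul, AddSubgroupClass.coe_nsmul, hk]; rfl))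
    rw [hx0, map_zero]
  have hrel : M₀.relIndex φ.ker ≠ 0 := AddSubgroup.FiniteIndex.index_ne_zero
  have hdvd : Nat.card σ.range ∣ M₀.relIndex φ.ker := by
    rw [AddSubgroup.relIndex, AddSubgroup.index_eq_card]
    exact AddSubgroup.card_addSubgroup_dvd_card σ.range
  -- assemble
  calc Nat.card (B ⧸ fB.range)
      ≤ Nat.card ((B ⧸ B₀) ⧸ ψ.range) := Nat.card_le_card_of_surjective π' hπ'surj
    _ = Nat.card ψ.ker := natCard_quotient_range_eq_natCard_ker ψ
    _ ≤ Nat.card (fB.ker.map (QuotientAddGroup.mk' B₀)) := AddSubgroup.card_le_of_le hker_le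
    _ = Nat.card σ.range := by rw [hρrange, hcardρσ]
    _ ≤ p ^ padicValNat p (M₀.relIndex φ.ker) :=
        natCard_le_pow_padicValNat_of_dvd p hσp hrel hdvd

/-- **The same for the `p`-primary component `B = M[p^∞]`** (Greenberg's `B_v = E(K_{∞,w})[p^∞]`),
with `fB` the restriction of `φ`. [cite: GreenbergLNM1716, §3 Lemma 3.3 (p. 87)] -/
theorem natCard_primaryComponent_quotient_range_le (p : ℕ) [Fact p.Prime]
    (φ : M →+ M) (M₀ : AddSubgroup M) [M₀.FiniteIndex] (hM₀ : ∀ x ∈ M₀, φ x ∈ M₀)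
    (fB : AddCommGroup.primaryComponent M p →+ AddCommGroup.primaryComponent M p)
    (hfB : ∀ b, (fB b : M) = φ b)
    (hsurj : ∀ b ∈ AddCommGroup.primaryComponent M p, b ∈ M₀ →
      ∃ b' ∈ AddCommGroup.primaryComponent M p, b' ∈ M₀ ∧ φ b' = b) :
    Finite (AddCommGroup.primaryComponent M p ⧸ fB.range) ∧
      Nat.card (AddCommGroup.primaryComponent M p ⧸ fB.range) ≤
        p ^ padicValNat p (M₀.relIndex φ.ker) :=
  natCard_quotient_range_le_pow_padicValNat_relIndex p φ M₀ hM₀ _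
    (fun _ hb ↦ (AddCommGroup.mem_primaryComponent).mp hb) fB hfB hsurj

end Summit.BirchSwinnertonDyer.Rank1Residual.X11b.TamagawaCoinvariants
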